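import Summits.QuantumFields.BalabanUV.T4Continuum.Spine.NE1p.DressedSmallFieldOnCores
import Summits.QuantumFields.BalabanUV.T4Continuum.Spine.NE1p.DressedSmallFieldInductionFaces

/-!
# T⁴ programme, spine estimate NE1′ (node O3b/H2) — THE (B1)-DISCHARGED SMALL-FIELD ENDs OF N0p WITHOUT A RADIUS BINDER AND
# WITHOUT A GEOMETRY HYPOTHESIS: the ϱ-free print-clause forms of §4's CORES ENDs over a `B13Resummation.Geometry` (N0m §4∕§4b's
# arithmetic BY NAME, sharp room 3) and the TORUS forms of §3∕§4 at pv22's `tgeometry 4 N` with located numerals (crew FACE row)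

Cell `pub-balaban`, sub-cell `t4`, BINDER-OWNERS row NE1′ (owner lineage t4-ne1p-p1); crew seat `b2b-balaban-t4-ne1p-formalise-leaf-03`
(LEAF PROVER 03, generation 10); crew row S27 (typer R-T110 (vi-a); INTENT `CLAIMS.log` 2026-08-20T15:52:59Z; owner g27 «GO — NOT MINE»).
ADDITIVE — imports the owner's N0p `Spine/NE1p/DressedSmallFieldOnCores` (p224732; ⇒ N0o `DressedSmallFieldGeometry` ⇒ N0m
`DressedSmallFieldInduction` v1.2, row NE5's `Support/B13TermParamGaussianBiProd`) and crew row S26 `Spine/NE1p/DressedSmallFieldInductionFaces`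
(p223789; ⇒ S24 `DressedSmallFieldGeometryFaces` for `K₀_four`) ONLY — as booked (typer R-T110 (vi-a), row S27 ∕ DAG N29zm); THEOREMS ONLY
(+ one `example`; 0 `def`, 0 `def … : Prop`); nothing of N0p ∕ N0o ∕ N0m ∕ S24 ∕ S26 ∕ row NE5 restated.

WHY THIS FILE.  N0p discharges (B1)'s ANALYTIC half ((E1)∕(E2) `hhol`∕`hm` along the table pencil) BY NAME from row NE5's structural
shape `TermHistExpLinear` — §3 for any exp-linear term family, §4 for the (2.14)-cores of the format of record (`BiCore`∕`termBi`) — but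
EVERY N0p END keeps (i) a `G : B13Resummation.Geometry` with the clauses at `G`'s letters (`hrate : r₁ + 2·G.κ₀ + 2 ≤ R`,
`hsmall : (A₀ + ϱA₁)·e^{b+1}·G.K₀·G.ν·G.c₁ ≤ 1`) and (ii) N0m §2's radius conditions `hϱ : 2 ≤ ϱ`, `hϱA : A₀ ≤ ϱ·A₁`.  After N0o ∕ S24 ∕
S25 ∕ S26 every OTHER small-field END has a form with NO geometry hypothesis on the tree's CONSTRUCTED torus geometry and (for the
induction face) a ϱ-FREE form.  THIS FILE wires the same for N0p, nothing else — the S24 ∕ S25 ∕ S26 pattern verbatim: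
* §1 over ONE `G : Geometry D Cube`: `attachedPart_locE_le_of_cores_printClause_three` — N0p §4 `attachedPart_locE_le_of_cores` at the
  pencil radius `ϱ⋆ := max 2 (A₀/A₁)` with `hϱ` ∕ `hϱA` ∕ `hsmall` SUPPLIED BY NAME by N0m's `two_le_pencilRadius` ∕
  `intercept_le_pencilRadius_mul` ∕ `pencilClause_of_printClause_three` (v1.2 §4b, the SHARP room) under a live slope `0 < A₁ ≤ A₀` and
  «ε₁ small at the UNDRESSED constant» `h3 : 3·A₀·(e^{b₅+1}·G.K₀·G.ν·G.c₁) ≤ 1`; `attachedPart_locE_le_of_cores_pencil_printClause_three` —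
  the same for §4's linear-pencil END (`h₀ + s•w`, pencil data = two radius inequalities READ AT `ϱ⋆`).  The pencil's disc, the indexing
  `hact` and (B3)'s weight `e^{N₁R₀}` are READ AT `ϱ⋆` — the radius is not eliminable from them, exactly as in N0m's own ϱ-free ENDs.
* §2 at `tgeometry 4 N` (pv22; `D := tsys 4 N`, d_{k+1} = `torusTreeLen`, incompatibility `TTouch`; all fields PROVED there), constants
  LOCATED AS NUMERALS as in S24 ∕ S25 ∕ S26 §2 (N0o `torus_consts` + S24 `K₀_four`: ν = 9, κ₀ = 64·log 162, c₁ = 64, K₀ = `B12TreeDecay.K₀ 64 8`;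
  print's (2.27) `c = 5` through N0p's `hb` at `b = 5·r₁`): `attachedPart_locE_le_of_expLinear_torus`, `muPart_locE_le_of_expLinear_torus`
  (N0p §3), `attachedPart_locE_le_of_cores_pencil_torus` (N0p §4) and `attachedPart_locE_le_of_cores_pencil_printClause_three_torus` (§1 on
  the torus) — NO geometry hypothesis in any of them, NO radius binder in the last; conclusions LITERALLY the right-hand sides of S25's
  `attachedPart_locE_le_torus` ∕ N0o's `muPart_locE_le_torus` currency.
* §3 one `example` (one currency, in kernel): §2's `attachedPart_locE_le_of_expLinear_torus` IS N0o `attachedPart_locE_le_geom` on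
  `tgeometry 4 N` with (E1)∕(E2) supplied by N0p §2 `differentiableOn_act_of_terms` ∕ `norm_act_le_of_terms` BY NAME — NO new inequality.
WHAT STAYS DISPLAYED (binders, by name; NOTHING instantiated on Bałaban's densities): the structural shape `hexp` (§3 forms; for cores a
THEOREM, N0p §4) ∕ the operator letters `hm`∕`hN`∕`hq` and the room `hroom` (§4 forms — rows NE2∕NE3's Gaussian data, row NE5's binders
verbatim); the table pencil inside the class (`hcurve`∕`hK`∕`hR`, or the two radius inequalities `hO`∕`hH`) — (w6)-type bookkeeping; the
placement `hscale` and the INDEXING `hact` ((B1)'s bookkeeping half); (B3) `hL3` — ONE (2.38)-SHAPE inequality on the parameter masses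
(= GAPS G-ne9p2-5, UNPRINTED, shared with NE9; a BINDER, never `[cite:`-tagged); `hA₀`, `hA₁` (`0 < A₁`, `A₁ ≤ A₀` for the ϱ-free forms),
`hr₁`, and the located clauses «κ large» `r₁ + 2·(64·log 162) + 2 ≤ R` and «ε₁ small» in one of the SHAPES `(A₀ + ϱA₁)·E ≤ 1` ∕
`3·A₀·E ≤ 1`, `E = e^{5r₁+1}·K₀(64,8)·9·64` ((B5): the SHAPES and the factor `3` are the owner's arithmetic consumed BY NAME, not
re-derived; their standing against print's NUMBERS is untouched).  (B4) is discharged BY NAME on pv22's CONSTRUCTED torus geometry; the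
identification of `tsys 4 N` ∕ `torusTreeLen` with Bałaban's 𝐃_{k+1} ∕ d_{k+1} is pv22's READING (DIVERGENCE D-pv22.3), not asserted here
— statements about typed SHAPES; no wall item moves; the wall line v1.6 does NOT move; R-t4r2-Q2 NOT met thereby.
HONEST FRAMING.  Kernel bookkeeping; printed loci ([Balaban1988RGII] (2.14) p. 15, (2.18) p. 16, (1.26) p. 8, (2.27) ∕ (2.30) p. 18,
(2.38) p. 20, p. 21; [Balaban1987RGI] p. 251, p. 257) are TYPE ∕ CONTEXT through the imported [cite]-tagged Literature modules,
re-asserted nowhere; ABSOLUTE RULE honoured ([folklore] kernel lemmas only).  NE1′ ⇐ the named binders — NOT printed, NOT proved;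
0 leaves instantiated on Bałaban's densities; spine PROVED 0∕9; count 9 unchanged.  Rung (B)+1 on ONE finite four-torus — NOT infinite
volume, NOT a mass gap, NOT OS on ℝ⁴, NOT Clay.  HONEST DEPENDENCY: continuum YM on T⁴ ⇐ BetaPertH ∧ nine spine estimates (0/9
proved); BetaPertH ⇐ (D1) ∧ (D4) ∧ CAP+tail; G-an2-4 gates asym, D1 and NE2/3/4.
-/
noncomputable section

namespace Summit.QuantumFields.BalabanUV.T4Continuum.NE1p.DressedSmallFieldOnCoresFaces

open Metric Set Complex MeasureTheory
open scoped BigOperators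
open Literature.MathematicalPhysics.QuantumFieldTheory.Balaban1983to89 (LocDomainSys)
open Literature.MathematicalPhysics.QuantumFieldTheory.Balaban1983to89.T4OutputRate (Carriers)
open Literature.MathematicalPhysics.QuantumFieldTheory.Balaban1983to89.B13Resummation (locE Geometry)
open Literature.MathematicalPhysics.QuantumFieldTheory.Balaban1983to89.T4InputCauchyRateSpecies (ballClass)
open Literature.MathematicalPhysics.QuantumFieldTheory.Balaban1983to89.T4InputCauchyRateTermwise (TermHistExpLinear)
open Literature.MathematicalPhysics.QuantumFieldTheory.Balaban1983to89.TreeLengthTorus (tsys torusTreeLen)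
open Literature.MathematicalPhysics.QuantumFieldTheory.Balaban1983to89.TreeLengthTorusGeometry (TTouch tgeometry)
open Literature.MathematicalPhysics.QuantumFieldTheory.Balaban1983to89.B12TreeDecay (K₀ K₀_pos)
open Summit.QuantumFields.BalabanUV.T4Continuum.B13HistMeasurable (MeasPotFrame B13HistM)
open Summit.QuantumFields.BalabanUV.T4Continuum.B13TermParamGaussianBi (BiCore termBi)
open Summit.QuantumFields.BalabanUV.T4Continuum.NE1p.DressedSmallFieldOnCores (differentiableOn_act_of_terms
  norm_act_le_of_terms attachedPart_locE_le_of_expLinear muPart_locE_le_of_expLinear attachedPart_locE_le_of_cores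
  attachedPart_locE_le_of_cores_pencil)
open Summit.QuantumFields.BalabanUV.T4Continuum.NE1p.DressedSmallFieldInduction (two_le_pencilRadius
  intercept_le_pencilRadius_mul pencilClause_of_two_two pencilClause_of_printClause_three)
open Summit.QuantumFields.BalabanUV.T4Continuum.NE1p.DressedSmallFieldGeometry (attachedPart_locE_le_geom torus_consts)
open Summit.QuantumFields.BalabanUV.T4Continuum.NE1p.DressedSmallFieldGeometryFaces (K₀_four)

/-! ## §1 THE ϱ-FREE FORMS OF THE CORES ENDs OVER A `B13Resummation.Geometry` — N0m §4∕§4b's arithmetic BY NAME (sharp room 3) -/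

section OfGeometry

variable {C : Carriers} {P : MeasPotFrame C} {𝒴 : Type*} {dom : 𝒴 → C.Dom} {Op : Type*} [NormedAddCommGroup Op]
  [NormedSpace ℂ Op] {ι : Type*} {β : ℕ → ι → Type*} [∀ k i, MeasurableSpace (β k i)] {α : ℕ → ι → Type*}
  [∀ k i, NormedAddCommGroup (α k i)] [∀ k i, InnerProductSpace ℝ (α k i)] [∀ k i, FiniteDimensional ℝ (α k i)]
  [∀ k i, MeasurableSpace (α k i)] [∀ k i, BorelSpace (α k i)]
variable (D : LocDomainSys) {Cube : Type} [DecidableEq Cube] (G : Geometry D Cube)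

open Classical in
/-- **THE CORES END UNDER PRINT'S CLAUSE WITH THE SHARP FACTOR-3 ROOM — NO RADIUS BINDER** (kernel; N0p §4
`attachedPart_locE_le_of_cores` BY NAME at the pencil radius `ϱ⋆ := max 2 (A₀/A₁)`, its `hϱ` ∕ `hϱA` ∕ `hsmall` SUPPLIED by N0m §4∕§4b's
`two_le_pencilRadius` ∕ `intercept_le_pencilRadius_mul` ∕ `pencilClause_of_printClause_three` BY NAME): for a live attached slope
`0 < A₁ ≤ A₀`, «κ large» `hrate`, «ε₁ small AT THE UNDRESSED CONSTANT with the sharp factor-3 room» (N0m v1.2 §4b)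
`h3 : 3·A₀·(e^{b₅+1}·G.K₀·G.ν·G.c₁) ≤ 1` — the remaining
binders being N0p's verbatim (operator letters `hm`∕`hN`∕`hq`, room `hroom`, the table pencil `hc` on the disc of radius `ϱ⋆`
with `hK`∕`hR`, placement `hscale`, indexing `hact`, (B3) `hL3` at the affine constant `A₀ + ϱ⋆·A₁`) — the attached part built
from (2.14)-cores is `≤ 4·(e·G.ν·G.c₁·G.K₀²)·A₁·e^{−r₁ d(X₀)}`.  The radius is not eliminable from the pencil's disc and from
(B3)'s weight `e^{N₁R₀}`: they are READ AT `ϱ⋆`, exactly as in N0m v1.1's own ϱ-free END.  (The companion for EVERY live slope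
`0 < A₁` under `(2·A₀ + 2·A₁)·(…) ≤ 1` is the same two lines with `pencilClause_of_two_two` — S26's `…twoTwoClause…` pattern; not
repeated here.) [folklore] -/
theorem attachedPart_locE_le_of_cores_printClause_three {W : Set (ℕ → ℝ)}
    {ctr : ℕ → (ℕ → ℝ) → C.BgB → Op × B13HistM P} {ROp RHist R' : ℕ → ℝ}
    (𝔊 : ∀ k i, C.Dom → BiCore P dom Op (β k i) (α k i)) {mq bq N₀ : ℕ → ι → C.Dom → ℝ} (hroom : ∀ k, ROp k < R' k)
    (hm : ∀ k, ∀ g ∈ W, ∀ (U : C.BgB) (X : C.Dom), C.scale X = k → ∀ i, 0 < mq k i X)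
    (hN : ∀ k, ∀ g ∈ W, ∀ (U : C.BgB) (X : C.Dom), C.scale X = k → ∀ i,
      (∀ o ∈ ball (ctr k g U).1 (R' k), AEStronglyMeasurable ((𝔊 k i X).N o) (𝔊 k i X).lam) ∧
      (∀ p, DifferentiableOn ℂ (fun o => (𝔊 k i X).N o p) (ball (ctr k g U).1 (R' k))) ∧
      (∀ o ∈ ball (ctr k g U).1 (R' k), ∀ p, ‖(𝔊 k i X).N o p‖ ≤ N₀ k i X))
    (hq : ∀ k, ∀ g ∈ W, ∀ (U : C.BgB) (X : C.Dom), C.scale X = k → ∀ i,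
      (∀ o ∈ ball (ctr k g U).1 (R' k),
        AEStronglyMeasurable (Function.uncurry ((𝔊 k i X).q o)) ((𝔊 k i X).lam.prod volume)) ∧
      (∀ p v, DifferentiableOn ℂ (fun o => (𝔊 k i X).q o p v) (ball (ctr k g U).1 (R' k))) ∧
      (∀ o ∈ ball (ctr k g U).1 (R' k), ∀ p v, mq k i X * ‖v‖ ^ 2 - bq k i X ≤ ((𝔊 k i X).q o p v).re))
    {k : ℕ} {g : ℕ → ℝ} (hg : g ∈ W) {U : C.BgB} {o : Op} {hc : ℂ → B13HistM P} {R₀ A₀ A₁ : ℝ}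
    (hcurve : DifferentiableOn ℂ hc (ball (0 : ℂ) (max 2 (A₀ / A₁))))
    (hK : ∀ s ∈ ball (0 : ℂ) (max 2 (A₀ / A₁)), (o, hc s) ∈ ballClass ctr ROp RHist k g U)
    (hR : ∀ s ∈ ball (0 : ℂ) (max 2 (A₀ / A₁)), ‖hc s‖ ≤ R₀)
    {emb : D.Dom → C.Dom} (hscale : ∀ Z, C.scale (emb Z) = k) {terms : D.Dom → Finset ι} {act : ℂ → D.Dom → ℂ}
    (hact : ∀ s ∈ ball (0 : ℂ) (max 2 (A₀ / A₁)), ∀ Z, act s Z = ∑ i ∈ terms Z, termBi 𝔊 k i o (hc s) (emb Z))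
    {R r₁ b₅ : ℝ} {X₀ : D.Dom} (hA₀ : 0 ≤ A₀) (hA₁ : 0 < A₁) (hle : A₁ ≤ A₀) (hr₁ : 0 ≤ r₁) (hb : r₁ * 5 ≤ b₅)
    (hrate : r₁ + 2 * G.κ₀ + 2 ≤ R) (h3 : 3 * A₀ * (Real.exp (b₅ + 1) * G.K₀ * G.ν * G.c₁) ≤ 1)
    (hL3 : ∀ Z, G.cubes Z ⊆ G.cubes X₀ →
      ∑ i ∈ terms Z, (∫ z, ‖(𝔊 k i (emb Z)).w z.1 * (𝔊 k i (emb Z)).N o z.1 *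
          ((𝔊 k i (emb Z)).chi z.2 * cexp (-(𝔊 k i (emb Z)).q o z.1 z.2))‖ ∂((𝔊 k i (emb Z)).lam.prod volume)) *
        Real.exp ((𝔊 k i (emb Z)).N₁ * R₀) ≤ (A₀ + max 2 (A₀ / A₁) * A₁) * Real.exp (-(R * D.dj Z))) :
    ‖locE G.ι G.cubes (act 1) (G.cubes X₀) - locE G.ι G.cubes (act 0) (G.cubes X₀)‖ ≤
      4 * (Real.exp 1 * G.ν * G.c₁ * G.K₀ ^ 2) * A₁ * Real.exp (-(r₁ * D.dj X₀)) := by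
  have hE : 0 ≤ Real.exp (b₅ + 1) * G.K₀ * G.ν * G.c₁ :=
    mul_nonneg (mul_nonneg (mul_nonneg (Real.exp_nonneg _) G.K₀_nonneg) G.ν_nonneg) G.c₁_nonneg
  have hsmall : (A₀ + max 2 (A₀ / A₁) * A₁) * Real.exp (b₅ + 1) * G.K₀ * G.ν * G.c₁ ≤ 1 := by
    simpa only [mul_assoc] using pencilClause_of_printClause_three hA₁ hle hE h3
  exact attachedPart_locE_le_of_cores D G 𝔊 hroom hm hN hq hg hcurve hK hR hscale hact hA₀ hA₁.le hr₁ hb hrate hsmall hL3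
    (two_le_pencilRadius A₀ A₁) (intercept_le_pencilRadius_mul hA₁)

open Classical in
/-- **THE SAME ALONG THE LINEAR TABLE-STRENGTH PENCIL `s ↦ h₀ + s • w`, ϱ-FREE** (kernel; N0p §4 `attachedPart_locE_le_of_cores_pencil`
BY NAME at `ϱ⋆ = max 2 (A₀/A₁)` under print's clause with the sharp factor-3 room): the pencil data are the two radius inequalities `hO` and
`hH : ‖h₀ − ctr.2‖ + ϱ⋆·‖w‖ ≤ RHist k` — «the undressed table plus the attached table inflated by the pencil radius stays in the
class's history ball» READ AT `ϱ⋆` (this is where the (w6) window is consumed: `‖w‖ ∝ |μ|`). [folklore] -/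
theorem attachedPart_locE_le_of_cores_pencil_printClause_three {W : Set (ℕ → ℝ)}
    {ctr : ℕ → (ℕ → ℝ) → C.BgB → Op × B13HistM P} {ROp RHist R' : ℕ → ℝ}
    (𝔊 : ∀ k i, C.Dom → BiCore P dom Op (β k i) (α k i)) {mq bq N₀ : ℕ → ι → C.Dom → ℝ} (hroom : ∀ k, ROp k < R' k)
    (hm : ∀ k, ∀ g ∈ W, ∀ (U : C.BgB) (X : C.Dom), C.scale X = k → ∀ i, 0 < mq k i X)
    (hN : ∀ k, ∀ g ∈ W, ∀ (U : C.BgB) (X : C.Dom), C.scale X = k → ∀ i,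
      (∀ o ∈ ball (ctr k g U).1 (R' k), AEStronglyMeasurable ((𝔊 k i X).N o) (𝔊 k i X).lam) ∧
      (∀ p, DifferentiableOn ℂ (fun o => (𝔊 k i X).N o p) (ball (ctr k g U).1 (R' k))) ∧
      (∀ o ∈ ball (ctr k g U).1 (R' k), ∀ p, ‖(𝔊 k i X).N o p‖ ≤ N₀ k i X))
    (hq : ∀ k, ∀ g ∈ W, ∀ (U : C.BgB) (X : C.Dom), C.scale X = k → ∀ i,
      (∀ o ∈ ball (ctr k g U).1 (R' k),
        AEStronglyMeasurable (Function.uncurry ((𝔊 k i X).q o)) ((𝔊 k i X).lam.prod volume)) ∧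
      (∀ p v, DifferentiableOn ℂ (fun o => (𝔊 k i X).q o p v) (ball (ctr k g U).1 (R' k))) ∧
      (∀ o ∈ ball (ctr k g U).1 (R' k), ∀ p v, mq k i X * ‖v‖ ^ 2 - bq k i X ≤ ((𝔊 k i X).q o p v).re))
    {k : ℕ} {g : ℕ → ℝ} (hg : g ∈ W) {U : C.BgB} {o : Op} {h₀ w : B13HistM P} {A₀ A₁ : ℝ}
    (hO : ‖o - (ctr k g U).1‖ ≤ ROp k) (hH : ‖h₀ - (ctr k g U).2‖ + max 2 (A₀ / A₁) * ‖w‖ ≤ RHist k)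
    {emb : D.Dom → C.Dom} (hscale : ∀ Z, C.scale (emb Z) = k) {terms : D.Dom → Finset ι} {act : ℂ → D.Dom → ℂ}
    (hact : ∀ s ∈ ball (0 : ℂ) (max 2 (A₀ / A₁)), ∀ Z, act s Z = ∑ i ∈ terms Z, termBi 𝔊 k i o (h₀ + s • w) (emb Z))
    {R r₁ b₅ : ℝ} {X₀ : D.Dom} (hA₀ : 0 ≤ A₀) (hA₁ : 0 < A₁) (hle : A₁ ≤ A₀) (hr₁ : 0 ≤ r₁) (hb : r₁ * 5 ≤ b₅)
    (hrate : r₁ + 2 * G.κ₀ + 2 ≤ R) (h3 : 3 * A₀ * (Real.exp (b₅ + 1) * G.K₀ * G.ν * G.c₁) ≤ 1)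
    (hL3 : ∀ Z, G.cubes Z ⊆ G.cubes X₀ →
      ∑ i ∈ terms Z, (∫ z, ‖(𝔊 k i (emb Z)).w z.1 * (𝔊 k i (emb Z)).N o z.1 *
          ((𝔊 k i (emb Z)).chi z.2 * cexp (-(𝔊 k i (emb Z)).q o z.1 z.2))‖ ∂((𝔊 k i (emb Z)).lam.prod volume)) *
        Real.exp ((𝔊 k i (emb Z)).N₁ * (‖h₀‖ + max 2 (A₀ / A₁) * ‖w‖)) ≤
          (A₀ + max 2 (A₀ / A₁) * A₁) * Real.exp (-(R * D.dj Z))) :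
    ‖locE G.ι G.cubes (act 1) (G.cubes X₀) - locE G.ι G.cubes (act 0) (G.cubes X₀)‖ ≤
      4 * (Real.exp 1 * G.ν * G.c₁ * G.K₀ ^ 2) * A₁ * Real.exp (-(r₁ * D.dj X₀)) := by
  have hE : 0 ≤ Real.exp (b₅ + 1) * G.K₀ * G.ν * G.c₁ :=
    mul_nonneg (mul_nonneg (mul_nonneg (Real.exp_nonneg _) G.K₀_nonneg) G.ν_nonneg) G.c₁_nonneg
  have hsmall : (A₀ + max 2 (A₀ / A₁) * A₁) * Real.exp (b₅ + 1) * G.K₀ * G.ν * G.c₁ ≤ 1 := by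
    simpa only [mul_assoc] using pencilClause_of_printClause_three hA₁ hle hE h3
  exact attachedPart_locE_le_of_cores_pencil D G 𝔊 hroom hm hN hq hg hO hH hscale hact hA₀ hA₁.le hr₁ hb hrate hsmall hL3
    (two_le_pencilRadius A₀ A₁) (intercept_le_pencilRadius_mul hA₁)

end OfGeometry

/-! ## §2 ON THE TORUS OF THE PAPERS (pv22's `tgeometry 4 N`): NO geometry hypothesis, clauses LOCATED AS NUMERALS (S24 ∕ S25 ∕ S26
§2 pattern: ν = 9, κ₀ = 64·log 162, c₁ = 64, K₀ = `B12TreeDecay.K₀ 64 8`, print's (2.27) `c = 5`, `b = 5·r₁`) -/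

section Torus

variable {N : ℕ} [NeZero N]

section ExpLinear

variable {C : Carriers} {Op Hist : Type*} [NormedAddCommGroup Hist] [NormedSpace ℂ Hist] {ι : Type*}
  {K : ℕ → (ℕ → ℝ) → C.BgB → Set (Op × Hist)} {T : ℕ → ι → Op → Hist → C.Dom → ℂ}
  {W : Set (ℕ → ℝ)} {α : ℕ → ι → Type*} [∀ k i, MeasurableSpace (α k i)] {μ : ∀ k i, Op → C.Dom → Measure (α k i)}
  {Φ : ∀ k i, Op → C.Dom → α k i → ℂ} {Λ : ∀ k i, Op → C.Dom → α k i → (Hist →L[ℂ] ℂ)}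

open Classical in
/-- **THE (B1)-DISCHARGED INDUCTION FACE ON THE TORUS — NO GEOMETRY HYPOTHESIS** (kernel; N0p §3 `attachedPart_locE_le_of_expLinear`
at `D := tsys 4 N`, `G := tgeometry 4 N`, constants located by N0o `torus_consts` + S24 `K₀_four`): under the structural shape
`TermHistExpLinear K T W μ Φ Λ`, along a table pencil inside the class on the disc `‖s‖ < ϱ`, with explicit a.e. read-out bounds
`Nb`, «κ large» `r₁ + 2·(64·log 162) + 2 ≤ R`, «ε₁ small» `(A₀ + ϱA₁)·e^{5r₁+1}·K₀(64,8)·9·64 ≤ 1`, N0m's `2 ≤ ϱ`, `A₀ ≤ ϱA₁` and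
the (2.38)-SHAPE (B3) `hL3` of the parameter masses: on a scale-(k+1) torus domain `X₀` the attached part is
`≤ 4·(e·9·64·K₀(64,8)²)·A₁·e^{−r₁·torusTreeLen X₀}` — LITERALLY the right-hand side of S25's `attachedPart_locE_le_torus`, whose
(E1)∕(E2) binders `hhol`∕`hm` are here DISCHARGED by the shape (N0p §2). [folklore] -/
theorem attachedPart_locE_le_of_expLinear_torus (hexp : TermHistExpLinear K T W μ Φ Λ) {k : ℕ} {g : ℕ → ℝ} (hg : g ∈ W)
    {U : C.BgB} {o : Op} {hc : ℂ → Hist} {ϱ R₀ : ℝ} (hcurve : DifferentiableOn ℂ hc (ball (0 : ℂ) ϱ))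
    (hK : ∀ s ∈ ball (0 : ℂ) ϱ, (o, hc s) ∈ K k g U) (hR : ∀ s ∈ ball (0 : ℂ) ϱ, ‖hc s‖ ≤ R₀)
    {emb : (tsys 4 N).Dom → C.Dom} (hscale : ∀ Z, C.scale (emb Z) = k) {terms : (tsys 4 N).Dom → Finset ι}
    {act : ℂ → (tsys 4 N).Dom → ℂ}
    (hact : ∀ s ∈ ball (0 : ℂ) ϱ, ∀ Z, act s Z = ∑ i ∈ terms Z, T k i o (hc s) (emb Z)) {Nb : (tsys 4 N).Dom → ι → ℝ}
    (hN0 : ∀ Z i, 0 ≤ Nb Z i) (hN : ∀ Z, ∀ i ∈ terms Z, ∀ᵐ a ∂μ k i o (emb Z), ‖Λ k i o (emb Z) a‖ ≤ Nb Z i)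
    {A₀ A₁ R r₁ : ℝ} (X₀ : (tsys 4 N).Dom) (hA₀ : 0 ≤ A₀) (hA₁ : 0 ≤ A₁) (hr₁ : 0 ≤ r₁)
    (hrate : r₁ + 2 * (64 * Real.log 162) + 2 ≤ R)
    (hsmall : (A₀ + ϱ * A₁) * Real.exp (5 * r₁ + 1) * K₀ 64 8 * 9 * 64 ≤ 1)
    (hL3 : ∀ Z : (tsys 4 N).Dom, Z.1 ⊆ X₀.1 →
      ∑ i ∈ terms Z, (∫ a, ‖Φ k i o (emb Z) a‖ ∂μ k i o (emb Z)) * Real.exp (Nb Z i * R₀) ≤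
        (A₀ + ϱ * A₁) * Real.exp (-(R * torusTreeLen Z.1)))
    (hϱ : 2 ≤ ϱ) (hϱA : A₀ ≤ ϱ * A₁) :
    ‖locE (TTouch (d := 4) (N := N)) (fun Z : (tsys 4 N).Dom => Z.1) (act 1) X₀.1 -
        locE (TTouch (d := 4) (N := N)) (fun Z : (tsys 4 N).Dom => Z.1) (act 0) X₀.1‖ ≤
      4 * (Real.exp 1 * 9 * 64 * K₀ 64 8 ^ 2) * A₁ * Real.exp (-(r₁ * torusTreeLen X₀.1)) := by
  obtain ⟨hν, hκ, hc⟩ := torus_consts N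
  have hK₀ := K₀_four (N := N)
  have h := attachedPart_locE_le_of_expLinear (tsys 4 N) (tgeometry 4 N) hexp hg hcurve hK hR hscale hact hN0 hN (R := R)
    (b := 5 * r₁) (X₀ := X₀) hA₀ hA₁ hr₁ (le_of_eq (by ring)) (by rw [hκ]; exact hrate) (by rw [hK₀, hν, hc]; exact hsmall) hL3 hϱ hϱA
  rw [hν, hc, hK₀] at h
  exact h

open Classical in
/-- **THE (B1)-DISCHARGED μ-PART ON THE TORUS — NO GEOMETRY HYPOTHESIS** (kernel; N0p §3 `muPart_locE_le_of_expLinear` at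
`tgeometry 4 N`, constants located): along a SOURCE pencil `‖s‖ < μ₁` inside the class, for `0 < μ₀ < μ₁`, `‖sμ‖ ≤ μ₀`, the μ-part
is `≤ e·9·64·K₀(64,8)²·A·e^{−r₁·torusTreeLen X₀}·μ₀/(μ₁ − μ₀)` — S24's `muPart…_torus` right-hand sides' currency. [folklore] -/
theorem muPart_locE_le_of_expLinear_torus (hexp : TermHistExpLinear K T W μ Φ Λ) {k : ℕ} {g : ℕ → ℝ} (hg : g ∈ W)
    {U : C.BgB} {o : Op} {hc : ℂ → Hist} {μ₁ R₀ : ℝ} (hcurve : DifferentiableOn ℂ hc (ball (0 : ℂ) μ₁))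
    (hK : ∀ s ∈ ball (0 : ℂ) μ₁, (o, hc s) ∈ K k g U) (hR : ∀ s ∈ ball (0 : ℂ) μ₁, ‖hc s‖ ≤ R₀)
    {emb : (tsys 4 N).Dom → C.Dom} (hscale : ∀ Z, C.scale (emb Z) = k) {terms : (tsys 4 N).Dom → Finset ι}
    {act : ℂ → (tsys 4 N).Dom → ℂ}
    (hact : ∀ s ∈ ball (0 : ℂ) μ₁, ∀ Z, act s Z = ∑ i ∈ terms Z, T k i o (hc s) (emb Z)) {Nb : (tsys 4 N).Dom → ι → ℝ}
    (hN0 : ∀ Z i, 0 ≤ Nb Z i) (hN : ∀ Z, ∀ i ∈ terms Z, ∀ᵐ a ∂μ k i o (emb Z), ‖Λ k i o (emb Z) a‖ ≤ Nb Z i)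
    {A R r₁ μ₀ : ℝ} (X₀ : (tsys 4 N).Dom) {sμ : ℂ} (hA : 0 ≤ A) (hr₁ : 0 ≤ r₁)
    (hrate : r₁ + 2 * (64 * Real.log 162) + 2 ≤ R) (hsmall : A * Real.exp (5 * r₁ + 1) * K₀ 64 8 * 9 * 64 ≤ 1)
    (hL3 : ∀ Z : (tsys 4 N).Dom, Z.1 ⊆ X₀.1 →
      ∑ i ∈ terms Z, (∫ a, ‖Φ k i o (emb Z) a‖ ∂μ k i o (emb Z)) * Real.exp (Nb Z i * R₀) ≤
        A * Real.exp (-(R * torusTreeLen Z.1)))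
    (h0 : 0 < μ₀) (h01 : μ₀ < μ₁) (hμ : ‖sμ‖ ≤ μ₀) :
    ‖locE (TTouch (d := 4) (N := N)) (fun Z : (tsys 4 N).Dom => Z.1) (act sμ) X₀.1 -
        locE (TTouch (d := 4) (N := N)) (fun Z : (tsys 4 N).Dom => Z.1) (act 0) X₀.1‖ ≤
      Real.exp 1 * 9 * 64 * K₀ 64 8 ^ 2 * A * Real.exp (-(r₁ * torusTreeLen X₀.1)) * (μ₀ / (μ₁ - μ₀)) := by
  obtain ⟨hν, hκ, hc⟩ := torus_consts N
  have hK₀ := K₀_four (N := N)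
  have h := muPart_locE_le_of_expLinear (tsys 4 N) (tgeometry 4 N) hexp hg hcurve hK hR hscale hact hN0 hN (R := R)
    (b := 5 * r₁) (X₀ := X₀) (sμ := sμ) hA hr₁ (le_of_eq (by ring)) (by rw [hκ]; exact hrate) (by rw [hK₀, hν, hc]; exact hsmall) hL3 h0
    h01 hμ
  rw [hν, hc, hK₀] at h
  exact h

end ExpLinear

section Cores

variable {C : Carriers} {P : MeasPotFrame C} {𝒴 : Type*} {dom : 𝒴 → C.Dom} {Op : Type*} [NormedAddCommGroup Op]
  [NormedSpace ℂ Op] {ι : Type*} {β : ℕ → ι → Type*} [∀ k i, MeasurableSpace (β k i)] {α : ℕ → ι → Type*}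
  [∀ k i, NormedAddCommGroup (α k i)] [∀ k i, InnerProductSpace ℝ (α k i)] [∀ k i, FiniteDimensional ℝ (α k i)]
  [∀ k i, MeasurableSpace (α k i)] [∀ k i, BorelSpace (α k i)]

open Classical in
/-- **THE CORES END ALONG THE LINEAR PENCIL ON THE TORUS — NO GEOMETRY HYPOTHESIS** (kernel; N0p §4
`attachedPart_locE_le_of_cores_pencil` at `tgeometry 4 N`, constants located): for cores of the format of record with the operator
letters `hm`∕`hN`∕`hq` and room `hroom`, pencil `h₀ + s•w` with the two radius inequalities, indexing `hact`, the located clauses and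
(B3) `hL3` on the cores' parameter masses: the attached part on a torus domain `X₀` is
`≤ 4·(e·9·64·K₀(64,8)²)·A₁·e^{−r₁·torusTreeLen X₀}`. [folklore] -/
theorem attachedPart_locE_le_of_cores_pencil_torus {W : Set (ℕ → ℝ)}
    {ctr : ℕ → (ℕ → ℝ) → C.BgB → Op × B13HistM P} {ROp RHist R' : ℕ → ℝ}
    (𝔊 : ∀ k i, C.Dom → BiCore P dom Op (β k i) (α k i)) {mq bq N₀ : ℕ → ι → C.Dom → ℝ} (hroom : ∀ k, ROp k < R' k)
    (hm : ∀ k, ∀ g ∈ W, ∀ (U : C.BgB) (X : C.Dom), C.scale X = k → ∀ i, 0 < mq k i X)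
    (hN : ∀ k, ∀ g ∈ W, ∀ (U : C.BgB) (X : C.Dom), C.scale X = k → ∀ i,
      (∀ o ∈ ball (ctr k g U).1 (R' k), AEStronglyMeasurable ((𝔊 k i X).N o) (𝔊 k i X).lam) ∧
      (∀ p, DifferentiableOn ℂ (fun o => (𝔊 k i X).N o p) (ball (ctr k g U).1 (R' k))) ∧
      (∀ o ∈ ball (ctr k g U).1 (R' k), ∀ p, ‖(𝔊 k i X).N o p‖ ≤ N₀ k i X))
    (hq : ∀ k, ∀ g ∈ W, ∀ (U : C.BgB) (X : C.Dom), C.scale X = k → ∀ i,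
      (∀ o ∈ ball (ctr k g U).1 (R' k),
        AEStronglyMeasurable (Function.uncurry ((𝔊 k i X).q o)) ((𝔊 k i X).lam.prod volume)) ∧
      (∀ p v, DifferentiableOn ℂ (fun o => (𝔊 k i X).q o p v) (ball (ctr k g U).1 (R' k))) ∧
      (∀ o ∈ ball (ctr k g U).1 (R' k), ∀ p v, mq k i X * ‖v‖ ^ 2 - bq k i X ≤ ((𝔊 k i X).q o p v).re))
    {k : ℕ} {g : ℕ → ℝ} (hg : g ∈ W) {U : C.BgB} {o : Op} {h₀ w : B13HistM P} {ϱ : ℝ}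
    (hO : ‖o - (ctr k g U).1‖ ≤ ROp k) (hH : ‖h₀ - (ctr k g U).2‖ + ϱ * ‖w‖ ≤ RHist k)
    {emb : (tsys 4 N).Dom → C.Dom} (hscale : ∀ Z, C.scale (emb Z) = k) {terms : (tsys 4 N).Dom → Finset ι}
    {act : ℂ → (tsys 4 N).Dom → ℂ}
    (hact : ∀ s ∈ ball (0 : ℂ) ϱ, ∀ Z, act s Z = ∑ i ∈ terms Z, termBi 𝔊 k i o (h₀ + s • w) (emb Z))
    {A₀ A₁ R r₁ : ℝ} (X₀ : (tsys 4 N).Dom) (hA₀ : 0 ≤ A₀) (hA₁ : 0 ≤ A₁) (hr₁ : 0 ≤ r₁)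
    (hrate : r₁ + 2 * (64 * Real.log 162) + 2 ≤ R)
    (hsmall : (A₀ + ϱ * A₁) * Real.exp (5 * r₁ + 1) * K₀ 64 8 * 9 * 64 ≤ 1)
    (hL3 : ∀ Z : (tsys 4 N).Dom, Z.1 ⊆ X₀.1 →
      ∑ i ∈ terms Z, (∫ z, ‖(𝔊 k i (emb Z)).w z.1 * (𝔊 k i (emb Z)).N o z.1 *
          ((𝔊 k i (emb Z)).chi z.2 * cexp (-(𝔊 k i (emb Z)).q o z.1 z.2))‖ ∂((𝔊 k i (emb Z)).lam.prod volume)) *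
        Real.exp ((𝔊 k i (emb Z)).N₁ * (‖h₀‖ + ϱ * ‖w‖)) ≤ (A₀ + ϱ * A₁) * Real.exp (-(R * torusTreeLen Z.1)))
    (hϱ : 2 ≤ ϱ) (hϱA : A₀ ≤ ϱ * A₁) :
    ‖locE (TTouch (d := 4) (N := N)) (fun Z : (tsys 4 N).Dom => Z.1) (act 1) X₀.1 -
        locE (TTouch (d := 4) (N := N)) (fun Z : (tsys 4 N).Dom => Z.1) (act 0) X₀.1‖ ≤
      4 * (Real.exp 1 * 9 * 64 * K₀ 64 8 ^ 2) * A₁ * Real.exp (-(r₁ * torusTreeLen X₀.1)) := by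
  obtain ⟨hν, hκ, hc⟩ := torus_consts N
  have hK₀ := K₀_four (N := N)
  have h := attachedPart_locE_le_of_cores_pencil (tsys 4 N) (tgeometry 4 N) 𝔊 hroom hm hN hq hg hO hH hscale hact (R := R)
    (b₅ := 5 * r₁) (X₀ := X₀) hA₀ hA₁ hr₁ (le_of_eq (by ring)) (by rw [hκ]; exact hrate) (by rw [hK₀, hν, hc]; exact hsmall) hL3 hϱ hϱA
  rw [hν, hc, hK₀] at h
  exact h

open Classical in
/-- **THE CORES END ALONG THE LINEAR PENCIL ON THE TORUS, ϱ-FREE — NO GEOMETRY HYPOTHESIS, NO RADIUS BINDER** (kernel; §1's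
`attachedPart_locE_le_of_cores_pencil_printClause_three` at `tgeometry 4 N`, constants located): live slope `0 < A₁ ≤ A₀`, «κ large»
`r₁ + 2·(64·log 162) + 2 ≤ R`, «ε₁ small with the sharp factor-3 room» `3·A₀·(e^{5r₁+1}·K₀(64,8)·9·64) ≤ 1`, the pencil data READ AT
`ϱ⋆ = max 2 (A₀/A₁)` ⇒ the same located bound. [folklore] -/
theorem attachedPart_locE_le_of_cores_pencil_printClause_three_torus {W : Set (ℕ → ℝ)}
    {ctr : ℕ → (ℕ → ℝ) → C.BgB → Op × B13HistM P} {ROp RHist R' : ℕ → ℝ}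
    (𝔊 : ∀ k i, C.Dom → BiCore P dom Op (β k i) (α k i)) {mq bq N₀ : ℕ → ι → C.Dom → ℝ} (hroom : ∀ k, ROp k < R' k)
    (hm : ∀ k, ∀ g ∈ W, ∀ (U : C.BgB) (X : C.Dom), C.scale X = k → ∀ i, 0 < mq k i X)
    (hN : ∀ k, ∀ g ∈ W, ∀ (U : C.BgB) (X : C.Dom), C.scale X = k → ∀ i,
      (∀ o ∈ ball (ctr k g U).1 (R' k), AEStronglyMeasurable ((𝔊 k i X).N o) (𝔊 k i X).lam) ∧
      (∀ p, DifferentiableOn ℂ (fun o => (𝔊 k i X).N o p) (ball (ctr k g U).1 (R' k))) ∧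
      (∀ o ∈ ball (ctr k g U).1 (R' k), ∀ p, ‖(𝔊 k i X).N o p‖ ≤ N₀ k i X))
    (hq : ∀ k, ∀ g ∈ W, ∀ (U : C.BgB) (X : C.Dom), C.scale X = k → ∀ i,
      (∀ o ∈ ball (ctr k g U).1 (R' k),
        AEStronglyMeasurable (Function.uncurry ((𝔊 k i X).q o)) ((𝔊 k i X).lam.prod volume)) ∧
      (∀ p v, DifferentiableOn ℂ (fun o => (𝔊 k i X).q o p v) (ball (ctr k g U).1 (R' k))) ∧
      (∀ o ∈ ball (ctr k g U).1 (R' k), ∀ p v, mq k i X * ‖v‖ ^ 2 - bq k i X ≤ ((𝔊 k i X).q o p v).re))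
    {k : ℕ} {g : ℕ → ℝ} (hg : g ∈ W) {U : C.BgB} {o : Op} {h₀ w : B13HistM P} {A₀ A₁ : ℝ}
    (hO : ‖o - (ctr k g U).1‖ ≤ ROp k) (hH : ‖h₀ - (ctr k g U).2‖ + max 2 (A₀ / A₁) * ‖w‖ ≤ RHist k)
    {emb : (tsys 4 N).Dom → C.Dom} (hscale : ∀ Z, C.scale (emb Z) = k) {terms : (tsys 4 N).Dom → Finset ι}
    {act : ℂ → (tsys 4 N).Dom → ℂ}
    (hact : ∀ s ∈ ball (0 : ℂ) (max 2 (A₀ / A₁)), ∀ Z, act s Z = ∑ i ∈ terms Z, termBi 𝔊 k i o (h₀ + s • w) (emb Z))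
    {R r₁ : ℝ} (X₀ : (tsys 4 N).Dom) (hA₀ : 0 ≤ A₀) (hA₁ : 0 < A₁) (hle : A₁ ≤ A₀) (hr₁ : 0 ≤ r₁)
    (hrate : r₁ + 2 * (64 * Real.log 162) + 2 ≤ R) (h3 : 3 * A₀ * (Real.exp (5 * r₁ + 1) * K₀ 64 8 * 9 * 64) ≤ 1)
    (hL3 : ∀ Z : (tsys 4 N).Dom, Z.1 ⊆ X₀.1 →
      ∑ i ∈ terms Z, (∫ z, ‖(𝔊 k i (emb Z)).w z.1 * (𝔊 k i (emb Z)).N o z.1 *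
          ((𝔊 k i (emb Z)).chi z.2 * cexp (-(𝔊 k i (emb Z)).q o z.1 z.2))‖ ∂((𝔊 k i (emb Z)).lam.prod volume)) *
        Real.exp ((𝔊 k i (emb Z)).N₁ * (‖h₀‖ + max 2 (A₀ / A₁) * ‖w‖)) ≤
          (A₀ + max 2 (A₀ / A₁) * A₁) * Real.exp (-(R * torusTreeLen Z.1))) :
    ‖locE (TTouch (d := 4) (N := N)) (fun Z : (tsys 4 N).Dom => Z.1) (act 1) X₀.1 -
        locE (TTouch (d := 4) (N := N)) (fun Z : (tsys 4 N).Dom => Z.1) (act 0) X₀.1‖ ≤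
      4 * (Real.exp 1 * 9 * 64 * K₀ 64 8 ^ 2) * A₁ * Real.exp (-(r₁ * torusTreeLen X₀.1)) := by
  obtain ⟨hν, hκ, hc⟩ := torus_consts N
  have hK₀ := K₀_four (N := N)
  have h := attachedPart_locE_le_of_cores_pencil_printClause_three (tsys 4 N) (tgeometry 4 N) 𝔊 hroom hm hN hq hg hO hH hscale
    hact (R := R) (b₅ := 5 * r₁) (X₀ := X₀) hA₀ hA₁ hle hr₁ (le_of_eq (by ring)) (by rw [hκ]; exact hrate)
    (by rw [hK₀, hν, hc]; exact h3) hL3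
  rw [hν, hc, hK₀] at h
  exact h

end Cores

/-! ## §3 Consistency — one currency, in kernel -/

section Consistency

variable {C : Carriers} {Op Hist : Type*} [NormedAddCommGroup Hist] [NormedSpace ℂ Hist] {ι : Type*}
  {K : ℕ → (ℕ → ℝ) → C.BgB → Set (Op × Hist)} {T : ℕ → ι → Op → Hist → C.Dom → ℂ}
  {W : Set (ℕ → ℝ)} {α : ℕ → ι → Type*} [∀ k i, MeasurableSpace (α k i)] {μ : ∀ k i, Op → C.Dom → Measure (α k i)}
  {Φ : ∀ k i, Op → C.Dom → α k i → ℂ} {Λ : ∀ k i, Op → C.Dom → α k i → (Hist →L[ℂ] ℂ)}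

open Classical in
/-- (E) §2's `attachedPart_locE_le_of_expLinear_torus` IS N0o `attachedPart_locE_le_geom` on `tgeometry 4 N` (S25's
`attachedPart_locE_le_torus` one level down) with (E1)∕(E2) `hhol`∕`hm` supplied by N0p §2 `differentiableOn_act_of_terms` ∕
`norm_act_le_of_terms` BY NAME and the majorant `m Z := Σ_{i ∈ terms Z} (∫‖Φ_i‖)·e^{Nb Z i·R₀}`: this file asserts NO new inequality.
[folklore] -/
example (hexp : TermHistExpLinear K T W μ Φ Λ) {k : ℕ} {g : ℕ → ℝ} (hg : g ∈ W)
    {U : C.BgB} {o : Op} {hc : ℂ → Hist} {ϱ R₀ : ℝ} (hcurve : DifferentiableOn ℂ hc (ball (0 : ℂ) ϱ))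
    (hK : ∀ s ∈ ball (0 : ℂ) ϱ, (o, hc s) ∈ K k g U) (hR : ∀ s ∈ ball (0 : ℂ) ϱ, ‖hc s‖ ≤ R₀)
    {emb : (tsys 4 N).Dom → C.Dom} (hscale : ∀ Z, C.scale (emb Z) = k) {terms : (tsys 4 N).Dom → Finset ι}
    {act : ℂ → (tsys 4 N).Dom → ℂ}
    (hact : ∀ s ∈ ball (0 : ℂ) ϱ, ∀ Z, act s Z = ∑ i ∈ terms Z, T k i o (hc s) (emb Z)) {Nb : (tsys 4 N).Dom → ι → ℝ}
    (hN0 : ∀ Z i, 0 ≤ Nb Z i) (hN : ∀ Z, ∀ i ∈ terms Z, ∀ᵐ a ∂μ k i o (emb Z), ‖Λ k i o (emb Z) a‖ ≤ Nb Z i)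
    {A₀ A₁ R r₁ : ℝ} (X₀ : (tsys 4 N).Dom) (hA₀ : 0 ≤ A₀) (hA₁ : 0 ≤ A₁) (hr₁ : 0 ≤ r₁)
    (hrate : r₁ + 2 * (64 * Real.log 162) + 2 ≤ R)
    (hsmall : (A₀ + ϱ * A₁) * Real.exp (5 * r₁ + 1) * K₀ 64 8 * 9 * 64 ≤ 1)
    (hL3 : ∀ Z : (tsys 4 N).Dom, Z.1 ⊆ X₀.1 →
      ∑ i ∈ terms Z, (∫ a, ‖Φ k i o (emb Z) a‖ ∂μ k i o (emb Z)) * Real.exp (Nb Z i * R₀) ≤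
        (A₀ + ϱ * A₁) * Real.exp (-(R * torusTreeLen Z.1)))
    (hϱ : 2 ≤ ϱ) (hϱA : A₀ ≤ ϱ * A₁) :
    ‖locE (TTouch (d := 4) (N := N)) (fun Z : (tsys 4 N).Dom => Z.1) (act 1) X₀.1 -
        locE (TTouch (d := 4) (N := N)) (fun Z : (tsys 4 N).Dom => Z.1) (act 0) X₀.1‖ ≤
      4 * (Real.exp 1 * 9 * 64 * K₀ 64 8 ^ 2) * A₁ * Real.exp (-(r₁ * torusTreeLen X₀.1)) := by
  obtain ⟨hν, hκ, hc⟩ := torus_consts N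
  have hK₀ := K₀_four (N := N)
  have h := attachedPart_locE_le_geom (tsys 4 N) (tgeometry 4 N)
    (m := fun Z => ∑ i ∈ terms Z, (∫ a, ‖Φ k i o (emb Z) a‖ ∂μ k i o (emb Z)) * Real.exp (Nb Z i * R₀)) (act := act)
    (R := R) (b := 5 * r₁) (X₀ := X₀) hA₀ hA₁ hr₁ (le_of_eq (by ring)) (by rw [hκ]; exact hrate)
    (by rw [hK₀, hν, hc]; exact hsmall)
    (fun Z _ => differentiableOn_act_of_terms hexp hg hcurve hK hscale hact Z)
    (fun _ hs Z _ => norm_act_le_of_terms hexp hg hK hR hscale hact hN0 hN hs Z) hL3 hϱ hϱA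
  rw [hν, hc, hK₀] at h
  exact h

end Consistency

end Torus

end Summit.QuantumFields.BalabanUV.T4Continuum.NE1p.DressedSmallFieldOnCoresFaces

end
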